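import Summits.BirchSwinnertonDyer.BirchSwinnertonDyer.Theorems.CyclotomicUntwistGNineToolkit
import Summits.BirchSwinnertonDyer.BirchSwinnertonDyer.Theorems.CyclotomicUntwistGNineKernelGeneric
import Summits.BirchSwinnertonDyer.Rank1Residual.Additive.AdicCompletionGaloisConj
import Mathlib.NumberTheory.NumberField.Cyclotomic.Ideal
import Mathlib.NumberTheory.Cyclotomic.Gal
import HarnessLib

/-!
# The place above `3` of a ninth cyclotomic field: Galois invariance, residues, `3/(ζ−1)⁶ ≡ −1`
# (kernel supply for the converse of `GNineCriterion`, route `CyclotomicUntwist`, crux K1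
# stmt-BirchSwinnertonDyer-21580)

HONEST FRAMING. Helper theorems only (`--supports stmt-BirchSwinnertonDyer-21580`); nothing about
BSD. For a `9`-th cyclotomic field `F/ℚ` and its place `w ∋ 3` (the prime `(ζ − 1)`, `e = 6`, `f = 1`):
* `asIdeal_eq_span_zeta_sub_one`, `valuation_algEquiv` — the prime above `3` is unique, so every
  `σ ∈ Gal(F/ℚ)` preserves `w`: `w(σ x) = w(x)` (via the tree's `LocalTransport.valuation_smul_eq`);
* `sq_sub_one_mem_of_notMem`, `val_sq_sub_one_lt_one` — the residue field is `𝔽₃`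
  (Mathlib `absNorm_span_zeta_sub_one`), so a `w`-UNIT of `𝓞 F` has square `≡ 1 (mod w)`;
* `val_three_div_pow_six_add_one_lt_one` — **`θ := 3/(ζ − 1)⁶ ≡ −1 (mod w)`**: explicitly
  `θ = 10 + 11ζ + 7ζ² + 10ζ³ + 4ζ⁴ − 4ζ⁵` and `θ + 1 = (ζ − 1)(28 + 17ζ + 10ζ² − 4ζ⁴) + 39`
  (the residue of `∏_{a ∈ (ℤ/9)^×} (ζ^a − 1)/(ζ − 1) ≡ ∏ a ≡ −1`); with `v` even this is what makes
  `3^v·U` a `w`-adic SQUARE only when `U ≡ 1 (mod 3)` — the discriminant end of the converse;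
* `val_pow_sub_one_lt_one`, small valuation bookkeeping.

References: L. Washington, *Cyclotomic Fields*, Lemma 1.4, Prop. 2.3 [Washington1997];
J. Neukirch, *ANT* II.§8 (conjugate places) [NeukirchANT1999].
-/

noncomputable section

open scoped NumberField Polynomial Pointwise

open IsDedekindDomain IsDedekindDomain.HeightOneSpectrum NumberField Polynomial
  Summit.BirchSwinnertonDyer.Rank1Residual.Additive.LocalTransport

-- D-0017 layout: summit = sub-problem ⇒ namespace `Summit.BirchSwinnertonDyer.BirchSwinnertonDyer.…`.
set_option linter.dupNamespace false

namespace Summit.BirchSwinnertonDyer.BirchSwinnertonDyer.Theorems.GNineConverse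

section General

variable {F : Type*} [Field F] [NumberField F] (w : HeightOneSpectrum (𝓞 F))

/-- `w(x) ≤ 1` and `w(x − 1) < 1` give `w(xᵏ − 1) < 1`. [folklore] -/
theorem val_pow_sub_one_lt_one {x : F} (hx : w.valuation F x ≤ 1) (h1 : w.valuation F (x - 1) < 1)
    (k : ℕ) : w.valuation F (x ^ k - 1) < 1 := by
  induction k with
  | zero => simp
  | succ k ih =>
    have e : x ^ (k + 1) - 1 = x * (x ^ k - 1) + (x - 1) := by ring
    rw [e]
    refine Valuation.map_add_lt _ ?_ h1
    rw [Valuation.map_mul]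
    exact GNine.mul_lt_one_of_le_of_lt' hx ih

end General

section Place

variable {F : Type} [Field F] [NumberField F] [hF : IsCyclotomicExtension {3 ^ (1 + 1)} ℚ F]
  (w : HeightOneSpectrum (𝓞 F)) (hw : (3 : 𝓞 F) ∈ w.asIdeal)

include hw

/-- **The prime above `3` is `(ζ − 1)`** for `ζ = IsCyclotomicExtension.zeta 9 ℚ F` (uniqueness of the
prime above a totally ramified prime; Mathlib `eq_span_zeta_sub_one_of_liesOver`). [cite: Washington1997, Lemma 1.4] -/
theorem asIdeal_eq_span_zeta_sub_one :
    w.asIdeal = Ideal.span {(IsCyclotomicExtension.zeta_spec (3 ^ (1 + 1)) ℚ F).toInteger - 1} := by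
  haveI : Fact (Nat.Prime 3) := ⟨Nat.prime_three⟩
  have hunder : w.asIdeal.under ℤ = Ideal.span {((3 : ℕ) : ℤ)} := by
    have hle : Ideal.span {((3 : ℕ) : ℤ)} ≤ w.asIdeal.under ℤ := by
      rw [Ideal.span_le, Set.singleton_subset_iff, SetLike.mem_coe, Ideal.under_def,
        Ideal.mem_comap, map_natCast]
      exact hw
    have hmax : (Ideal.span {((3 : ℕ) : ℤ)}).IsMaximal := by
      have hp : Prime ((3 : ℕ) : ℤ) := by norm_num
      exact ((Ideal.span_singleton_prime hp.ne_zero).mpr hp).isMaximal (by simp)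
    exact (hmax.eq_of_le (Ideal.IsPrime.ne_top inferInstance) hle).symm
  haveI hlies : w.asIdeal.LiesOver (Ideal.span {((3 : ℕ) : ℤ)}) := ⟨hunder.symm⟩
  exact IsCyclotomicExtension.Rat.eq_span_zeta_sub_one_of_liesOver 3 1 F
    (IsCyclotomicExtension.zeta_spec (3 ^ (1 + 1)) ℚ F) w.asIdeal

/-- **Every `σ ∈ Gal(F/ℚ)` fixes the prime above `3`**: `σ • 𝔭_w = 𝔭_w` (both are primes above `3`).
[cite: NeukirchANT1999, II.§8] -/
theorem smul_asIdeal_eq (σ : F ≃ₐ[ℚ] F) : σ • w.asIdeal = w.asIdeal := by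
  have h3 : σ • (3 : 𝓞 F) = 3 :=
    map_ofNat (MulSemiringAction.toRingHom (F ≃ₐ[ℚ] F) (𝓞 F) σ) 3
  have hw' : (3 : 𝓞 F) ∈ (smulPlace σ w).asIdeal := by
    rw [smulPlace_asIdeal]
    have := (Ideal.smul_mem_pointwise_smul_iff (a := σ) (S := w.asIdeal) (x := (3 : 𝓞 F))).mpr hw
    rwa [h3] at this
  rw [← smulPlace_asIdeal, asIdeal_eq_span_zeta_sub_one (smulPlace σ w) hw',
    asIdeal_eq_span_zeta_sub_one w hw]

/-- **Galois invariance of the place above `3`**: `w(σ x) = w(x)` for every `σ ∈ Gal(F/ℚ)` and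
`x ∈ F`. [cite: NeukirchANT1999, II.§8] -/
theorem valuation_algEquiv (σ : F ≃ₐ[ℚ] F) (x : F) : w.valuation F (σ x) = w.valuation F x :=
  valuation_smul_eq (g := σ) (w := w) (w' := w) (smul_asIdeal_eq w hw σ) x

/-- **The residue field at `w` is `𝔽₃`: a `w`-unit of `𝓞 F` has square `≡ 1`.** For `y ∈ 𝓞 F`,
`y ∉ 𝔭_w` implies `y² − 1 ∈ 𝔭_w` (`#(𝓞 F/𝔭_w) = N(ζ − 1) = 3`, Fermat in `𝔽₃`).
[cite: Washington1997, Lemma 1.4] -/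
theorem sq_sub_one_mem_of_notMem {y : 𝓞 F} (hy : y ∉ w.asIdeal) : y ^ 2 - 1 ∈ w.asIdeal := by
  haveI : Fact (Nat.Prime 3) := ⟨Nat.prime_three⟩
  set hζ := IsCyclotomicExtension.zeta_spec (3 ^ (1 + 1)) ℚ F
  have hspan := asIdeal_eq_span_zeta_sub_one w hw
  -- the quotient is a field with three elements
  haveI : w.asIdeal.IsMaximal := w.isMaximal
  letI : Field (𝓞 F ⧸ w.asIdeal) := Ideal.Quotient.field w.asIdeal
  have hcard : Nat.card (𝓞 F ⧸ w.asIdeal) = 3 := by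
    rw [← Submodule.cardQuot_apply, ← Ideal.absNorm_apply, hspan]
    exact_mod_cast IsCyclotomicExtension.Rat.absNorm_span_zeta_sub_one 3 1 hζ
  haveI : Finite (𝓞 F ⧸ w.asIdeal) := Nat.finite_of_card_ne_zero (by rw [hcard]; norm_num)
  letI : Fintype (𝓞 F ⧸ w.asIdeal) := Fintype.ofFinite _
  have hq : (Ideal.Quotient.mk w.asIdeal y) ^ 3 = Ideal.Quotient.mk w.asIdeal y := by
    have h := FiniteField.pow_card (Ideal.Quotient.mk w.asIdeal y)
    rwa [← Nat.card_eq_fintype_card, hcard] at h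
  have h3 : y ^ 3 - y ∈ w.asIdeal := by
    rw [← Ideal.Quotient.eq_zero_iff_mem, map_sub, map_pow, hq, sub_self]
  have hfac : y ^ 3 - y = y * (y ^ 2 - 1) := by ring
  rw [hfac] at h3
  exact ((Ideal.IsPrime.mem_or_mem inferInstance h3).resolve_left hy)

/-- Valuation form: for `y ∈ 𝓞 F` with `w(y) = 1`, `w(y² − 1) < 1`. [cite: Washington1997, Lemma 1.4] -/
theorem val_sq_sub_one_lt_one {y : 𝓞 F} (hy : w.valuation F (y : F) = 1) :
    w.valuation F ((y : F) ^ 2 - 1) < 1 := by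
  have hy' : y ∉ w.asIdeal := (valuation_eq_one_iff_notMem w).mp hy
  have h := sq_sub_one_mem_of_notMem w hw hy'
  have e : ((y : F) ^ 2 - 1) = ((y ^ 2 - 1 : 𝓞 F) : F) := by push_cast; ring
  rw [e]
  exact (valuation_lt_one_iff_mem w _).mpr h

/-- **`θ = 3/(ζ − 1)⁶ ≡ −1 (mod w)`**: explicitly `3/(ζ−1)⁶ = 10 + 11ζ + 7ζ² + 10ζ³ + 4ζ⁴ − 4ζ⁵`
and `θ + 1 = (ζ − 1)(28 + 17ζ + 10ζ² − 4ζ⁴) + 39`, so `w(θ + 1) < 1`; also `w(θ) = 1`.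
[cite: Washington1997, Lemma 1.4] -/
theorem val_three_div_pow_six_add_one_lt_one :
    w.valuation F (3 / (IsCyclotomicExtension.zeta (3 ^ (1 + 1)) ℚ F - 1) ^ 6 + 1) < 1 ∧
    w.valuation F (3 / (IsCyclotomicExtension.zeta (3 ^ (1 + 1)) ℚ F - 1) ^ 6) = 1 := by
  set ζ := IsCyclotomicExtension.zeta (3 ^ (1 + 1)) ℚ F with hζdef
  have hζ : IsPrimitiveRoot ζ 9 := IsCyclotomicExtension.zeta_spec (3 ^ (1 + 1)) ℚ F
  have hrel := GNine.zeta_rel hζ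
  have hπ : (ζ - 1 : F) ≠ 0 := sub_ne_zero.mpr (hζ.ne_one (by norm_num))
  -- `3/(ζ−1)⁶ = P(ζ)` with `P(ζ)(ζ−1)⁶ − 3 = Φ₉(ζ)·W(ζ) = 0`
  have hP : (3 : F) / (ζ - 1) ^ 6 = 10 + 11 * ζ + 7 * ζ ^ 2 + 10 * ζ ^ 3 + 4 * ζ ^ 4 - 4 * ζ ^ 5 := by
    rw [div_eq_iff (pow_ne_zero 6 hπ)]
    linear_combination (-7 + 49 * ζ - 91 * ζ ^ 2 + 74 * ζ ^ 3 - 28 * ζ ^ 4 + 4 * ζ ^ 5) * hrel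
  have hV : (10 + 11 * ζ + 7 * ζ ^ 2 + 10 * ζ ^ 3 + 4 * ζ ^ 4 - 4 * ζ ^ 5 : F) + 1 =
      (ζ - 1) * (28 + 17 * ζ + 10 * ζ ^ 2 - 4 * ζ ^ 4) + 39 := by ring
  have hVint : w.valuation F (28 + 17 * ζ + 10 * ζ ^ 2 - 4 * ζ ^ 4 : F) ≤ 1 := by
    have e : (28 + 17 * ζ + 10 * ζ ^ 2 - 4 * ζ ^ 4 : F) =
        aeval ζ (28 + 17 * X + 10 * X ^ 2 - 4 * X ^ 4 : ℤ[X]) := by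
      simp only [map_sub, map_add, map_mul, map_pow, aeval_X, map_ofNat]
    rw [e]; exact GNine.val_aeval_le_one w hζ _
  have hπlt : w.valuation F (ζ - 1) < 1 := by
    rw [← neg_sub, Valuation.map_neg]; exact GNine.val_one_sub_zeta_lt_one w hw hζ
  have h39 : w.valuation F (39 : F) < 1 := by
    rw [show (39 : F) = 3 * 13 by norm_num, Valuation.map_mul]
    exact mul_lt_one_of_lt_of_le (GNine.val_three_lt_one w hw) (by exact_mod_cast GNine.val_natCast_le_one w 13)
  refine ⟨?_, ?_⟩
  · rw [hP, hV]
    refine Valuation.map_add_lt _ ?_ h39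
    rw [Valuation.map_mul]
    exact mul_lt_one_of_lt_of_le hπlt hVint
  · -- `w(θ) = 1`: `θ + 1 ≡ 0` and `θ = (θ + 1) − 1`
    rw [hP]
    have h1 : w.valuation F ((10 + 11 * ζ + 7 * ζ ^ 2 + 10 * ζ ^ 3 + 4 * ζ ^ 4 - 4 * ζ ^ 5 : F) + 1) < 1 := by
      rw [hV]
      refine Valuation.map_add_lt _ ?_ h39
      rw [Valuation.map_mul]; exact mul_lt_one_of_lt_of_le hπlt hVint
    have e : (10 + 11 * ζ + 7 * ζ ^ 2 + 10 * ζ ^ 3 + 4 * ζ ^ 4 - 4 * ζ ^ 5 : F) =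
        ((10 + 11 * ζ + 7 * ζ ^ 2 + 10 * ζ ^ 3 + 4 * ζ ^ 4 - 4 * ζ ^ 5 : F) + 1) + (-1) := by ring
    have h1' : w.valuation F ((10 + 11 * ζ + 7 * ζ ^ 2 + 10 * ζ ^ 3 + 4 * ζ ^ 4 - 4 * ζ ^ 5 : F) + 1) <
        w.valuation F (-1 : F) := by rwa [Valuation.map_neg, Valuation.map_one]
    rw [e, Valuation.map_add_eq_of_lt_right _ h1', Valuation.map_neg, Valuation.map_one]

/-- `w(3^v) = exp(−6v)` and an integer prime to `3` is a `w`-unit. [cite: Washington1997, Lemma 1.4] -/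
theorem val_three_pow (v : ℕ) : w.valuation F ((3 : F) ^ v) = WithZero.exp (-(6 * (v : ℤ))) := by
  obtain ⟨-, h3, -⟩ := GNineCriterion.placeData_nine w hw
  rw [Valuation.map_pow, h3, ← WithZero.exp_nsmul]; congr 1; ring

omit hw in
/-- **Two generators of `Gal(F/ℚ) ≅ (ℤ/9)^×`**: there are `τ` (of order `3`, `ζ ↦ ζ⁴`) and `c`
(complex conjugation, `ζ ↦ ζ⁸`) with `τ³ = 1`, `c² = 1`, `τc = cτ`, and an element of `F` fixed by
both is RATIONAL (`(ℤ/9)^× = ⟨4⟩ × ⟨8⟩`, Galois correspondence). [cite: Washington1997, Prop. 2.3] -/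
theorem exists_generators_gal :
    ∃ τ c : F ≃ₐ[ℚ] F, τ ^ 3 = 1 ∧ c ^ 2 = 1 ∧ τ * c = c * τ ∧
      ∀ x : F, τ x = x → c x = x → x ∈ Set.range (algebraMap ℚ F) := by
  haveI : Fact (Nat.Prime 3) := ⟨Nat.prime_three⟩
  haveI := IsCyclotomicExtension.isGalois {3 ^ (1 + 1)} ℚ F
  have hirr : Irreducible (cyclotomic (3 ^ (1 + 1)) ℚ) := cyclotomic.irreducible_rat (by norm_num)
  let e := IsCyclotomicExtension.autEquivPow F hirr
  let u4 : (ZMod (3 ^ (1 + 1)))ˣ := ZMod.unitOfCoprime 4 (by decide)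
  let u8 : (ZMod (3 ^ (1 + 1)))ˣ := ZMod.unitOfCoprime 8 (by decide)
  have hgen : ∀ u : (ZMod (3 ^ (1 + 1)))ˣ, ∃ i : ℕ, i < 3 ∧ ∃ j : ℕ, j < 2 ∧ u = u4 ^ i * u8 ^ j := by
    decide
  refine ⟨e.symm u4, e.symm u8, ?_, ?_, ?_, fun x hτ hc ↦ ?_⟩
  · rw [← map_pow, show u4 ^ 3 = 1 by decide, map_one]
  · rw [← map_pow, show u8 ^ 2 = 1 by decide, map_one]
  · rw [← map_mul, ← map_mul, mul_comm]
  · refine (IsGalois.mem_range_algebraMap_iff_fixed x).mpr fun σ ↦ ?_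
    obtain ⟨i, -, j, -, hij⟩ := hgen (e σ)
    have hσ : σ = (e.symm u4) ^ i * (e.symm u8) ^ j := by
      apply e.injective
      rw [map_mul, map_pow, map_pow, e.apply_symm_apply, e.apply_symm_apply, hij]
    have hτi : ∀ i : ℕ, ((e.symm u4) ^ i) x = x := by
      intro i
      induction i with
      | zero => rfl
      | succ i ih => rw [pow_succ, AlgEquiv.mul_apply, hτ, ih]
    have hcj : ∀ j : ℕ, ((e.symm u8) ^ j) x = x := by
      intro j
      induction j with
      | zero => rfl
      | succ j ih => rw [pow_succ, AlgEquiv.mul_apply, hc, ih]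
    rw [hσ, AlgEquiv.mul_apply, hcj, hτi]

end Place

end Summit.BirchSwinnertonDyer.BirchSwinnertonDyer.Theorems.GNineConverse

end
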